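import Summits.CriticalPhenomena.Ising3DConformalLimit.Theorems.MonotoneBlockingMonotoneBlockingTwoKarlinComposition
import HarnessLib

/-!
# Line `Sketch` (idea `karlin-scale-tp2`) for the crux `MonotoneBlockingTwo` (BM₂, stmt-CriticalPhenomena-17054)
— lead's working skeleton, v2

Route `MonotoneBlocking`, sub-problem `CriticalPhenomena/Ising3DConformalLimit`. The vocabulary and the registered stub
statements `Sig.stub_*` live in the definitions module `Theorems/MonotoneBlockingMonotoneBlockingTwoKarlinDefs.lean`
(p158425, namespace `…Cruxes.MonotoneBlockingTwo.KarlinScaleTP2`). The six ANALYTIC stubs of v1 have landed and are imported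
through `Theorems/MonotoneBlockingMonotoneBlockingTwoKarlinComposition.lean` (p160401: `karlinComposition : KarlinComposition`,
the provable half of the line — scale-totally-positive kernels plus a non-negative nugget have monotone blocking — and the
conditional `monotoneBlockingTwo_of_criticalKarlinRepresentable`):

* `stub_fourFunctions` — continuous four-functions theorem on a chain (`…FourFunctions`, p159242);
* `stub_foldedTent_tp2` — the folded unit tent is TP₂ (`…FoldedTentTP2`, p159414);
* `stub_foldedBlockIntegral_tp2` — MTP₂ of the folded scaled block integral (`…FoldedBlockIntegralTP2`, p160124);
* `stub_convolution1D` — the 1-D lattice→continuum identity (`…Convolution1D`, p159818);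
* `stub_blockSum_cellSmear` — the exact continuum embedding of the block sum (`…BlockSumCellSmear`, p159844);
* `stub_fold` — folding to the open orthant (`…Fold`, p159633).

ONE stub remains, the TRANSFER (research stub): `stub_criticalKarlinRepresentable` — the critical two-point function of the
n.n. Ising model on `ℤ³` is `Γ⋆T + N𝟙₀` with `Γ ∈ 𝒦`, `N ≥ 0`. It is not derivable from the tree's qualitative knowledge of
`criticalTwoPoint 3`; its numerical feasibility against the infinite-volume axial table `G(n e₁)`, `n ≤ 8` (HelsonAxis) and
the off-axis MC values is the lead's live question (the class forces the local scaling exponent of `Γ` to be non-increasing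
along rays, while the lattice `s_eff` rises from 1.039 on `[1,2]` to 1.132 on `[2,3]`).
-/

noncomputable section

namespace Summit.CriticalPhenomena.Ising3DConformalLimit.Cruxes.MonotoneBlockingTwo.KarlinScaleTP2

open Summit.CriticalPhenomena.Ising3DConformalLimit.Theses.MonotoneBlocking (MonotoneBlockingTwo)

/-! ## The remaining registered stub (sorried here) -/

theorem stub_criticalKarlinRepresentable : Sig.stub_criticalKarlinRepresentable := by
  sorry

/-! ## The composition: the landed `KarlinComposition` and the transfer give the crux BY NAME -/

/-- **The line**: the transfer stub gives the crux, through the landed composition theorem. -/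
theorem MonotoneBlockingTwo_of : Sig.stub_criticalKarlinRepresentable → MonotoneBlockingTwo :=
  fun h => monotoneBlockingTwo_of_criticalKarlinRepresentable h

/-- **The crux `MonotoneBlockingTwo`** (route `MonotoneBlocking`, stmt-CriticalPhenomena-17054), BY NAME, from the one
remaining stub of line `Sketch` (karlin-scale-tp2). -/
theorem MonotoneBlockingTwo_proof : MonotoneBlockingTwo :=
  MonotoneBlockingTwo_of stub_criticalKarlinRepresentable

end Summit.CriticalPhenomena.Ising3DConformalLimit.Cruxes.MonotoneBlockingTwo.KarlinScaleTP2

end
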